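/-
Copyright (c) 2026 the pub-hodgecm-mathlib formalisation cell (harness21).  Prover seat hodgecm-mathlib-K2E5-p17 (g3) (free E5 hand on the E3 road),
Track B «K2-LIT» ∕ h413 (`stmt-HodgeConjecture-24833`), line `K2_E3_EllipticInputs`, unit U12-d, §L road «U-iso-T», brick (G⁺-b) LINE SIDE, part (L2′):
the POINTWISE line identity `𝓕f(k (tE₁₂) k⁻¹) = c · Ĝ_k(t)` and its weighted integrals.  2026-09-04.
-/
import Summits.HodgeConjecture.HodgeConjecture.Theorems.K2E3GL2RegularNilpotentFourierLineInversion   -- ★ p856988 (b-i) (this seat): chart, `isAddHaarMeasure_map_chart`, trace identities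
import HarnessLib

/-!
# K2_E3 road (h413), §L — (G⁺-b) line side (L2′): `𝓕_ψ f(k (tE₁₂) k⁻¹) = c · (G_k)^(t)` POINTWISE, and weighted line∕`K × F` integrals

Cell `pub/hodgecm-mathlib` (D-0151), Track B, seat K2E5-p17 (g3) (§L lead K2E3-p12 (g4); (G⁺-b) cut with K2E5-p10 (g4) 2026-09-04T04:23∕04:25Z: line side here,
`K`-side p10).  `--supports stmt-HodgeConjecture-24833 --as helper`; THEOREMS ONLY (no definition ∕ instance ∕ notation ∕ named fact ∕ `sorry`); never imports `Cruxes/…/Lines`.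
COUNT-NEUTRAL.

★ (b-i) p856988 proved the `t`-INTEGRATED identity `∫_F 𝓕f(k (tE₁₂) k⁻¹) dt = c′·G_k(0)`; the `G⁺ = det⁻¹(Nm)`-orbital measures of the two regular nilpotent
`G⁺`-orbits (★ p857116: `ν_{𝒪(aE₁₂)}(g) = ∫_{K×F} 1[a⁻¹·t·det k ∈ Nm] g(k (tE₁₂) k⁻¹)`) put a WEIGHT `χ̃(a⁻¹·t·det k)` (`χ = η_{E∕F}`, `1_{Nm} = (1+η̃)∕2`) in the
line variable, so the line side of (G⁺-b) needs the identity BEFORE the `t`-integration: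
* §1 **`matrixFourier_conjNilp_eq_fourierSB`** — ONE `c > 0` (`= addHaarScalarFactor μ𝔤 (chart_* dx⁴)`) with, for every `k ∈ GL₂(𝒪)` and `f ∈ C_c^∞(𝔤𝔩₂(F))`:
  the fibre integral `G_k(s) := ∫_{F³} f(k [[r₀,r₁],[s,r₂]] k⁻¹) dr` is SCHWARTZ–BRUHAT on `F`, and **`𝓕_ψ f(k (tE₁₂) k⁻¹) = c · (fourierSB ψ dx G_k)(t)` for every `t`**
  (same proof as ★ (b-i): `Ad(k)`-substitution, chart, `F⁴ = F × F³`, Fubini);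
* §2 **`integral_mul_matrixFourier_conjNilp_eq`** — for every weight `w : F → ℂ`: `∫ w(t)·𝓕f(k (tE₁₂) k⁻¹) dt = c·∫ w(t)·Ĝ_k(t) dt` (no integrability needed: both sides
  are the same integrand up to the constant); **`integral_prod_mul_matrixFourier_conjNilp_eq`** — for a bounded measurable weight `W` on `K × F`:
  `∫_{K×F} W(k,t)·𝓕f(k (tE₁₂) k⁻¹) d(κ⊗dt) = c·∫_K ∫_F W(k,t)·Ĝ_k(t) dt dκ` (Fubini by ★ `integrable_comp_conjNilp`).
With `W(k,t) = χ̃(a⁻¹·t·det k)` and the line inversion (T1) «`∫ χ̃·Ĝ = γ₀·(Z₀(G) + c₀·G(0))`» (file `K2E3LocalFieldQuadraticCharLineInversion`, this seat, next) this is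
the line side of `ν̂_{𝒪±}`; the `K`-side (K2E5-p10 (g4)) turns `∫_K χ̃(det k)·Z₀(G_k)` into a locally integrable density.
[HarishChandra1999AdmissibleDistributions, Thm. 4.4, Lemma 7.8; §7 (Fourier transforms of nilpotent orbital integrals)] [LabesseLanglands1979, §2 (unstable orbital
integrals for `SL₂`)] [Tate1950, §2.2].
HONEST LABEL: HC_CM is proved only modulo the 7 printed citations (2 remaining named inputs: hLiu418 = stmt-HodgeConjecture-24832, h413 = stmt-HodgeConjecture-24833)
until rung 0 closes; count-neutral helper; (G⁺-b)∕(LBU-2⁺) NOT ★.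
-/

set_option autoImplicit false
set_option linter.dupNamespace false   -- `Summit.HodgeConjecture.HodgeConjecture.…` (D-0017 nested layout; lakefile exemption for Summits)

noncomputable section

open MeasureTheory Measure Filter Topology
open scoped MatrixGroups NNReal ENNReal Pointwise
open Literature.NumberTheory.Rogawski1990 Literature.NumberTheory.Automorphic Literature.NumberTheory.Automorphic.LocalFieldHaar
open Literature.NumberTheory.GaloisRepresentations Literature.NumberTheory.GaloisRepresentations.IsNonarchimedeanLocalField
open Summit.HodgeConjecture.HodgeConjecture.Cruxes.H413.K2E3GL2RegularNilpotentOrbitalMeasure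
open Summit.HodgeConjecture.HodgeConjecture.Cruxes.H413.K2E3GLnLieAdIntegralInvariant
open Summit.HodgeConjecture.HodgeConjecture.Cruxes.H413.K2E3GLnNilpotentFourierPointSupport
open Summit.HodgeConjecture.HodgeConjecture.Cruxes.H413.K2E3GL2RegularNilpotentFourierLineInversion

namespace Summit.HodgeConjecture.HodgeConjecture.Cruxes.H413.K2E3GL2NilpotentFourierLinePointwise

variable {F : Type*} [Field F] [ValuativeRel F] [TopologicalSpace F] [IsNonarchimedeanLocalField F]
variable [MeasurableSpace F] [BorelSpace F] [MeasurableSpace (Matrix (Fin 2) (Fin 2) F)] [BorelSpace (Matrix (Fin 2) (Fin 2) F)]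

/-! ## §1  `𝓕f(k (tE₁₂) k⁻¹) = c · Ĝ_k(t)` pointwise, `G_k ∈ 𝒮(F)` -/

/-- **POINTWISE LINE IDENTITY.**  One constant `c > 0` (`= addHaarScalarFactor μ𝔤 (chart_* dx⁴)`) such that for every `k ∈ GL₂(𝒪)` and `f ∈ C_c^∞(𝔤𝔩₂(F))`: the fibre
integral `G_k(s) = ∫_{F³} f(k [[r₀,r₁],[s,r₂]] k⁻¹) dr` is Schwartz–Bruhat and `𝓕_ψ f(k (tE₁₂) k⁻¹) = c · Ĝ_k(t)` for EVERY `t ∈ F` (`Ĝ = fourierSB ψ dx G`).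
[cite: HarishChandra1999AdmissibleDistributions, Thm. 4.4 p. 11] [cite: Tate1950, §2.2] -/
theorem matrixFourier_conjNilp_eq_fourierSB (ψ : AddChar F Circle) (hψ : ψ.IsContinuousNontrivial)
    (μ𝔤 : Measure (Matrix (Fin 2) (Fin 2) F)) [μ𝔤.IsAddHaarMeasure] (dx : Measure F) [dx.IsAddHaarMeasure] :
    ∃ c : ℝ, 0 < c ∧ ∀ ⦃k : GL (Fin 2) F⦄, k ∈ glInt 2 F → ∀ ⦃f : Matrix (Fin 2) (Fin 2) F → ℂ⦄, IsLocSmooth f →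
      (fun s : F => ∫ r : Fin 3 → F, f ((k : Matrix (Fin 2) (Fin 2) F) * !![r 0, r 1; s, r 2] * ((k⁻¹ : GL (Fin 2) F) : Matrix (Fin 2) (Fin 2) F))
        ∂(Measure.pi fun _ : Fin 3 => dx)) ∈ SchwartzBruhat F ∧
      ∀ t : F, (fun Y : Matrix (Fin 2) (Fin 2) F => ∫ X, ((ψ (Matrix.trace (Y * X)) : Circle) : ℂ) * f X ∂μ𝔤)
          ((k : Matrix (Fin 2) (Fin 2) F) * !![0, t; 0, 0] * ((k⁻¹ : GL (Fin 2) F) : Matrix (Fin 2) (Fin 2) F)) =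
        (c : ℂ) * fourierSB ψ dx (fun s : F => ∫ r : Fin 3 → F,
          f ((k : Matrix (Fin 2) (Fin 2) F) * !![r 0, r 1; s, r 2] * ((k⁻¹ : GL (Fin 2) F) : Matrix (Fin 2) (Fin 2) F)) ∂(Measure.pi fun _ : Fin 3 => dx)) t := by
  classical
  haveI : T2Space F := (isLocalField F).toT2Space
  haveI : LocallyCompactSpace F := (isLocalField F).toLocallyCompactSpace
  haveI : SecondCountableTopology F := secondCountableTopology_localField F
  haveI : LocallyCompactSpace (Matrix (Fin 2) (Fin 2) F) := Pi.locallyCompactSpace_of_finite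
  haveI : SecondCountableTopology (Matrix (Fin 2) (Fin 2) F) := inferInstanceAs (SecondCountableTopology (Fin 2 → Fin 2 → F))
  -- Haar uniqueness: `μ𝔤 = c₂ • chart_* dx^{⊗4}`
  set ν : Measure (Matrix (Fin 2) (Fin 2) F) :=
    Measure.map (fun x : Fin 4 → F => (!![x 1, x 2; x 0, x 3] : Matrix (Fin 2) (Fin 2) F)) (Measure.pi fun _ : Fin 4 => dx) with hν
  haveI : ν.IsAddHaarMeasure := isAddHaarMeasure_map_chart dx
  have huniq : μ𝔤 = μ𝔤.addHaarScalarFactor ν • ν := isAddLeftInvariant_eq_smul μ𝔤 ν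
  set c₂ : ℝ≥0 := μ𝔤.addHaarScalarFactor ν with hc₂
  have hc₂pos : 0 < c₂ := addHaarScalarFactor_pos_of_isAddHaarMeasure μ𝔤 ν
  refine ⟨(c₂ : ℝ), NNReal.coe_pos.2 hc₂pos, fun k hk f hf => ?_⟩
  -- the chart as a homeomorphism / measurable equivalence
  let eH : (Fin 4 → F) ≃ₜ Matrix (Fin 2) (Fin 2) F :=
    { toFun := fun x => !![x 1, x 2; x 0, x 3]
      invFun := fun Y => ![Y 1 0, Y 0 0, Y 0 1, Y 1 1]
      left_inv := fun x => by funext i; fin_cases i <;> simp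
      right_inv := fun Y => by ext i j; fin_cases i <;> fin_cases j <;> simp
      continuous_toFun := continuous_chart
      continuous_invFun := continuous_chartInv }
  let e : (Fin 4 → F) ≃ᵐ Matrix (Fin 2) (Fin 2) F := eH.toMeasurableEquiv
  have he : (e : (Fin 4 → F) → Matrix (Fin 2) (Fin 2) F) = fun x => !![x 1, x 2; x 0, x 3] := rfl
  have hex : ∀ x : Fin 4 → F, e x = !![x 1, x 2; x 0, x 3] := fun x => rfl
  -- `Ad(k)` as a homeomorphism (for the compact support of `f ∘ Ad(k) ∘ chart`)
  have hkk : ((k⁻¹ : GL (Fin 2) F) : Matrix (Fin 2) (Fin 2) F) * (k : Matrix (Fin 2) (Fin 2) F) = 1 := by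
    rw [← Units.val_mul, inv_mul_cancel, Units.val_one]
  have hkk' : (k : Matrix (Fin 2) (Fin 2) F) * ((k⁻¹ : GL (Fin 2) F) : Matrix (Fin 2) (Fin 2) F) = 1 := by
    rw [← Units.val_mul, mul_inv_cancel, Units.val_one]
  let cH : Matrix (Fin 2) (Fin 2) F ≃ₜ Matrix (Fin 2) (Fin 2) F :=
    { toFun := fun X => (k : Matrix (Fin 2) (Fin 2) F) * X * ((k⁻¹ : GL (Fin 2) F) : Matrix (Fin 2) (Fin 2) F)
      invFun := fun X => ((k⁻¹ : GL (Fin 2) F) : Matrix (Fin 2) (Fin 2) F) * X * (k : Matrix (Fin 2) (Fin 2) F)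
      left_inv := fun X => by
        simp only [← Matrix.mul_assoc, hkk, Matrix.one_mul]
        rw [Matrix.mul_assoc, hkk, Matrix.mul_one]
      right_inv := fun X => by
        simp only [← Matrix.mul_assoc, hkk', Matrix.one_mul]
        rw [Matrix.mul_assoc, hkk', Matrix.mul_one]
      continuous_toFun := continuous_conj k
      continuous_invFun := by
        have h := continuous_conj (F := F) k⁻¹
        simp only [inv_inv] at h
        exact h }
  -- the transported test function `Φ = f ∘ Ad(k) ∘ chart ∈ 𝒮(F⁴)`
  set Φ : (Fin 4 → F) → ℂ :=
    fun x => f ((k : Matrix (Fin 2) (Fin 2) F) * e x * ((k⁻¹ : GL (Fin 2) F) : Matrix (Fin 2) (Fin 2) F)) with hΦ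
  have hΦSB : Φ ∈ SchwartzBruhat (Fin 4 → F) := by
    rw [mem_schwartzBruhat_iff]
    exact ⟨hf.isLocallyConstant.comp_continuous ((continuous_conj k).comp continuous_chart),
      hf.hasCompactSupport.comp_homeomorph (eH.trans cH)⟩
  -- splitting off the coordinate `0`: `F⁴ ≃ F × F³`
  let e0 : (Fin 4 → F) ≃ᵐ F × (Fin 3 → F) := MeasurableEquiv.piFinSuccAbove (fun _ : Fin 4 => F) 0
  have he0 : MeasurePreserving e0 (Measure.pi fun _ : Fin 4 => dx) (dx.prod (Measure.pi fun _ : Fin 3 => dx)) :=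
    measurePreserving_piFinSuccAbove (fun _ : Fin 4 => dx) 0
  -- the Schwartz–Bruhat fibre integral `G`
  set G : F → ℂ := fun s => ∫ r : Fin 3 → F, Φ (e0.symm (s, r)) ∂(Measure.pi fun _ : Fin 3 => dx) with hG
  have hGSB : G ∈ SchwartzBruhat F := by
    obtain ⟨N, hN⟩ := exists_forall_add_eq_of_mem_schwartzBruhat_pi hΦSB
    obtain ⟨n₀, hn₀⟩ := exists_eq_zero_of_notMem_piPrimePowBall hΦSB
    rw [mem_schwartzBruhat_iff]
    refine ⟨?_, ?_⟩
    · rw [IsLocallyConstant.iff_exists_open]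
      intro s
      refine ⟨s +ᵥ primePowBall F N, (isOpen_primePowBall N).vadd s,
        Set.mem_vadd_set.2 ⟨0, zero_mem_primePowBall N, by simp⟩, ?_⟩
      rintro s' ⟨u, hu, rfl⟩
      simp only [hG, vadd_eq_add]
      refine integral_congr_ae (Filter.Eventually.of_forall fun r => ?_)
      have hsplit : e0.symm (s + u, r) = e0.symm (s, r) + e0.symm (u, 0) := by
        funext j
        refine Fin.cases ?_ (fun i => ?_) j <;> simp [e0]
      show Φ (e0.symm (s + u, r)) = Φ (e0.symm (s, r))
      rw [hsplit]
      refine hN _ _ (mem_piPrimePowBall_iff.2 fun i => ?_)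
      refine Fin.cases ?_ (fun j => ?_) i
      · simpa [e0] using hu
      · simpa [e0] using zero_mem_primePowBall N
    · refine HasCompactSupport.intro' (isCompact_primePowBall n₀) (isClosed_primePowBall n₀) fun s hs => ?_
      simp only [hG]
      have hzero : (fun r : Fin 3 → F => Φ (e0.symm (s, r))) = fun _ => 0 := by
        funext r
        refine hn₀ _ fun h => hs ?_
        simpa [e0] using (mem_piPrimePowBall_iff.1 h) 0
      rw [hzero, integral_zero]
  -- STEP 1 (`Ad(k)`-substitution): `𝓕f(k (tE₁₂) k⁻¹) = ∫ ψ(t·Y₁₀) f(kYk⁻¹) dμ𝔤(Y)`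
  have step1 : ∀ t : F,
      (∫ X, ((ψ (Matrix.trace (((k : Matrix (Fin 2) (Fin 2) F) * !![0, t; 0, 0] * ((k⁻¹ : GL (Fin 2) F) : Matrix (Fin 2) (Fin 2) F)) * X)) : Circle) : ℂ) *
          f X ∂μ𝔤) =
        ∫ Y, ((ψ (t * Y 1 0) : Circle) : ℂ) * f ((k : Matrix (Fin 2) (Fin 2) F) * Y * ((k⁻¹ : GL (Fin 2) F) : Matrix (Fin 2) (Fin 2) F)) ∂μ𝔤 := by
    intro t
    rw [← integral_comp_conj_of_mem_glInt μ𝔤 hk (fun X => ((ψ (Matrix.trace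
      (((k : Matrix (Fin 2) (Fin 2) F) * !![0, t; 0, 0] * ((k⁻¹ : GL (Fin 2) F) : Matrix (Fin 2) (Fin 2) F)) * X)) : Circle) : ℂ) * f X)]
    refine integral_congr_ae (Filter.Eventually.of_forall fun Y => ?_)
    simp only
    rw [trace_conj_mul_conj, trace_nilp_mul]
  -- STEP 2 (chart): `∫ g dμ𝔤 = c₂ • ∫ g ∘ chart d(dx^{⊗4})`
  have step2 : ∀ g : Matrix (Fin 2) (Fin 2) F → ℂ,
      ∫ Y, g Y ∂μ𝔤 = ((c₂ : ℝ) : ℂ) * ∫ x : Fin 4 → F, g (e x) ∂(Measure.pi fun _ : Fin 4 => dx) := by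
    intro g
    rw [← integral_map_equiv e g]
    conv_lhs => rw [huniq]
    rw [integral_smul_nnreal_measure, NNReal.smul_def, Complex.real_smul]
    rfl
  -- STEP 3 (split + Fubini): the `t`-integrand is `c₂ • Ĝ(t)`
  have step3 : ∀ t : F,
      (∫ x : Fin 4 → F, ((ψ (t * (e x) 1 0) : Circle) : ℂ) *
          f ((k : Matrix (Fin 2) (Fin 2) F) * e x * ((k⁻¹ : GL (Fin 2) F) : Matrix (Fin 2) (Fin 2) F)) ∂(Measure.pi fun _ : Fin 4 => dx)) =
        fourierSB ψ dx G t := by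
    intro t
    -- the integrand on `F⁴` and its transport to `F × F³`
    have he10 : ∀ x : Fin 4 → F, (e x) 1 0 = x 0 := fun x => by simp [hex]
    have hgt_cont : Continuous fun x : Fin 4 → F => ((ψ (t * (e x) 1 0) : Circle) : ℂ) * Φ x := by
      refine Continuous.mul ?_ (hf.continuous.comp ((continuous_conj k).comp continuous_chart))
      refine continuous_subtype_val.comp (hψ.1.comp (continuous_const.mul ?_))
      simp only [he10]
      exact continuous_apply 0
    have hgt_cs : HasCompactSupport fun x : Fin 4 → F => ((ψ (t * (e x) 1 0) : Circle) : ℂ) * Φ x :=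
      ((mem_schwartzBruhat_iff.1 hΦSB).2).mul_left
    have hgt_int : Integrable (fun x : Fin 4 → F => ((ψ (t * (e x) 1 0) : Circle) : ℂ) * Φ x) (Measure.pi fun _ : Fin 4 => dx) :=
      hgt_cont.integrable_of_hasCompactSupport hgt_cs
    have htrans : (∫ x : Fin 4 → F, ((ψ (t * (e x) 1 0) : Circle) : ℂ) * Φ x ∂(Measure.pi fun _ : Fin 4 => dx)) =
        ∫ p : F × (Fin 3 → F), ((ψ (t * p.1) : Circle) : ℂ) * Φ (e0.symm p) ∂(dx.prod (Measure.pi fun _ : Fin 3 => dx)) := by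
      rw [← (he0.symm e0).integral_comp']
      refine integral_congr_ae (Filter.Eventually.of_forall fun p => ?_)
      simp only [hex]
      congr 4
    have hint' : Integrable (fun p : F × (Fin 3 → F) => ((ψ (t * p.1) : Circle) : ℂ) * Φ (e0.symm p))
        (dx.prod (Measure.pi fun _ : Fin 3 => dx)) := by
      have h := ((he0.symm e0).integrable_comp_emb e0.symm.measurableEmbedding).2 hgt_int
      refine h.congr (Filter.Eventually.of_forall fun p => ?_)
      simp only [Function.comp_apply, hex]
      congr 4
    show (∫ x : Fin 4 → F, ((ψ (t * (e x) 1 0) : Circle) : ℂ) * Φ x ∂(Measure.pi fun _ : Fin 4 => dx)) = fourierSB ψ dx G t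
    rw [htrans, integral_prod _ hint', fourierSB_apply]
    refine integral_congr_ae (Filter.Eventually.of_forall fun s => ?_)
    simp only [hG]
    rw [integral_const_mul, mul_comm s t]
  -- the fibre integral in the announced spelling
  have hGeq : G = fun s : F => ∫ r : Fin 3 → F,
      f ((k : Matrix (Fin 2) (Fin 2) F) * !![r 0, r 1; s, r 2] * ((k⁻¹ : GL (Fin 2) F) : Matrix (Fin 2) (Fin 2) F)) ∂(Measure.pi fun _ : Fin 3 => dx) := by
    funext s
    simp only [hG, hΦ]
    refine integral_congr_ae (Filter.Eventually.of_forall fun r => ?_)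
    have hmat : e (e0.symm (s, r)) = !![r 0, r 1; s, r 2] := by
      rw [hex]
      ext i j
      fin_cases i <;> fin_cases j <;> simp [e0] <;> rfl
    simp only [hmat]
  refine ⟨hGeq ▸ hGSB, fun t => ?_⟩
  show (∫ X, ((ψ (Matrix.trace (((k : Matrix (Fin 2) (Fin 2) F) * !![0, t; 0, 0] * ((k⁻¹ : GL (Fin 2) F) : Matrix (Fin 2) (Fin 2) F)) * X)) : Circle) : ℂ) *
      f X ∂μ𝔤) = _
  rw [step1 t, step2, step3 t, hGeq]

/-! ## §2  Weighted line and `K × F` integrals -/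

/-- **Weighted line integral**: `∫ w(t)·𝓕f(k (tE₁₂) k⁻¹) dt = c·∫ w(t)·Ĝ_k(t) dt` for EVERY `w : F → ℂ` and the constant∕`G_k` of `matrixFourier_conjNilp_eq_fourierSB`.
[cite: HarishChandra1999AdmissibleDistributions, Thm. 4.4 p. 11] -/
theorem integral_mul_matrixFourier_conjNilp_eq (ψ : AddChar F Circle) (hψ : ψ.IsContinuousNontrivial)
    (μ𝔤 : Measure (Matrix (Fin 2) (Fin 2) F)) [μ𝔤.IsAddHaarMeasure] (dx : Measure F) [dx.IsAddHaarMeasure] :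
    ∃ c : ℝ, 0 < c ∧ ∀ ⦃k : GL (Fin 2) F⦄, k ∈ glInt 2 F → ∀ ⦃f : Matrix (Fin 2) (Fin 2) F → ℂ⦄, IsLocSmooth f →
      (fun s : F => ∫ r : Fin 3 → F, f ((k : Matrix (Fin 2) (Fin 2) F) * !![r 0, r 1; s, r 2] * ((k⁻¹ : GL (Fin 2) F) : Matrix (Fin 2) (Fin 2) F))
        ∂(Measure.pi fun _ : Fin 3 => dx)) ∈ SchwartzBruhat F ∧
      ∀ (w : F → ℂ) (ρ : Measure F),
        ∫ t, w t * (fun Y : Matrix (Fin 2) (Fin 2) F => ∫ X, ((ψ (Matrix.trace (Y * X)) : Circle) : ℂ) * f X ∂μ𝔤)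
            ((k : Matrix (Fin 2) (Fin 2) F) * !![0, t; 0, 0] * ((k⁻¹ : GL (Fin 2) F) : Matrix (Fin 2) (Fin 2) F)) ∂ρ =
          (c : ℂ) * ∫ t, w t * fourierSB ψ dx (fun s : F => ∫ r : Fin 3 → F,
            f ((k : Matrix (Fin 2) (Fin 2) F) * !![r 0, r 1; s, r 2] * ((k⁻¹ : GL (Fin 2) F) : Matrix (Fin 2) (Fin 2) F)) ∂(Measure.pi fun _ : Fin 3 => dx)) t ∂ρ := by
  obtain ⟨c, hc, h⟩ := matrixFourier_conjNilp_eq_fourierSB ψ hψ μ𝔤 dx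
  refine ⟨c, hc, fun k hk f hf => ⟨(h hk hf).1, fun w ρ => ?_⟩⟩
  rw [← integral_const_mul]
  refine integral_congr_ae (Filter.Eventually.of_forall fun t => ?_)
  have hpt := (h hk hf).2 t
  simp only at hpt ⊢
  rw [hpt]
  ring

/-- **Weighted `K × F` integral** (the line side of the `G⁺`-orbital measures): for a measurable weight `W : ↥(GL₂(𝒪)) × F → ℂ` with `‖W‖ ≤ 1`, a finite-on-compacts `κ`
on `GL₂(𝒪)` and `f ∈ C_c^∞(𝔤𝔩₂(F))`, `∫_{K×F} W(k,t)·𝓕_ψ f(k (tE₁₂) k⁻¹) d(κ ⊗ dx) = c·∫_K ∫_F W(k,t)·Ĝ_k(t) dx(t) dκ(k)` (Fubini: the unweighted integrand is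
integrable by ★ `integrable_comp_conjNilp` ∘ ★ `isLocSmooth_matrixFourier`, and `W` is bounded).  With `W(k,t) = χ̃(a⁻¹·t·det k)` (`χ = η_{E∕F}`) this is the line side
of `ν̂_{𝒪(aE₁₂)}` (★ p857116). [cite: HarishChandra1999AdmissibleDistributions, §7] [cite: LabesseLanglands1979, §2] -/
theorem integral_prod_mul_matrixFourier_conjNilp_eq (ψ : AddChar F Circle) (hψ : ψ.IsContinuousNontrivial)
    (μ𝔤 : Measure (Matrix (Fin 2) (Fin 2) F)) [μ𝔤.IsAddHaarMeasure]
    [MeasurableSpace (GL (Fin 2) F)] [BorelSpace (GL (Fin 2) F)] (κ : Measure ↥(glInt 2 F)) [IsFiniteMeasureOnCompacts κ]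
    (dx : Measure F) [dx.IsAddHaarMeasure] :
    ∃ c : ℝ, 0 < c ∧ ∀ ⦃f : Matrix (Fin 2) (Fin 2) F → ℂ⦄, IsLocSmooth f → ∀ (W : ↥(glInt 2 F) × F → ℂ), Measurable W → (∀ p, ‖W p‖ ≤ 1) →
      ∫ p : ↥(glInt 2 F) × F, W p * (fun Y : Matrix (Fin 2) (Fin 2) F => ∫ X, ((ψ (Matrix.trace (Y * X)) : Circle) : ℂ) * f X ∂μ𝔤)
          (((p.1 : GL (Fin 2) F) : Matrix (Fin 2) (Fin 2) F) * !![0, p.2; 0, 0] * ((((p.1 : GL (Fin 2) F))⁻¹ : GL (Fin 2) F) : Matrix (Fin 2) (Fin 2) F)) ∂(κ.prod dx) =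
        (c : ℂ) * ∫ k : ↥(glInt 2 F), ∫ t : F, W (k, t) * fourierSB ψ dx (fun s : F => ∫ r : Fin 3 → F,
          f (((k : GL (Fin 2) F) : Matrix (Fin 2) (Fin 2) F) * !![r 0, r 1; s, r 2] * ((((k : GL (Fin 2) F))⁻¹ : GL (Fin 2) F) : Matrix (Fin 2) (Fin 2) F))
            ∂(Measure.pi fun _ : Fin 3 => dx)) t ∂dx ∂κ := by
  haveI : T2Space F := (isLocalField F).toT2Space
  haveI : LocallyCompactSpace F := (isLocalField F).toLocallyCompactSpace
  haveI : SecondCountableTopology F := secondCountableTopology_localField F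
  haveI : CompactSpace ↥(glInt 2 F) := isCompact_iff_compactSpace.1 (isCompact_glInt 2 F)
  haveI : IsFiniteMeasure κ := CompactSpace.isFiniteMeasure
  obtain ⟨c, hc, h⟩ := integral_mul_matrixFourier_conjNilp_eq ψ hψ μ𝔤 dx
  refine ⟨c, hc, fun f hf W hWm hWb => ?_⟩
  -- integrability of the weighted integrand on `K × F`
  have hint : Integrable (fun p : ↥(glInt 2 F) × F =>
      W p * (fun Y : Matrix (Fin 2) (Fin 2) F => ∫ X, ((ψ (Matrix.trace (Y * X)) : Circle) : ℂ) * f X ∂μ𝔤)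
        (((p.1 : GL (Fin 2) F) : Matrix (Fin 2) (Fin 2) F) * !![0, p.2; 0, 0] * ((((p.1 : GL (Fin 2) F))⁻¹ : GL (Fin 2) F) : Matrix (Fin 2) (Fin 2) F)))
      (κ.prod dx) := by
    have h0 := integrable_comp_conjNilp κ dx (isLocSmooth_matrixFourier hψ μ𝔤 hf)
    refine Integrable.mono' (h0.norm) (hWm.aestronglyMeasurable.mul h0.aestronglyMeasurable) (Filter.Eventually.of_forall fun p => ?_)
    rw [norm_mul]
    calc ‖W p‖ * _ ≤ 1 * _ := mul_le_mul_of_nonneg_right (hWb p) (norm_nonneg _)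
      _ = _ := one_mul _
  rw [integral_prod _ hint]
  refine (integral_congr_ae (Filter.Eventually.of_forall fun k : ↥(glInt 2 F) => ?_)).trans (integral_const_mul _ _)
  exact (h k.2 hf).2 (fun t => W (k, t)) dx

end Summit.HodgeConjecture.HodgeConjecture.Cruxes.H413.K2E3GL2NilpotentFourierLinePointwise

end
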